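import Summits.CriticalPhenomena.PercolationContinuityZ3.Theorems.PercNearOneGluingNoHeavyLowerTailSahiConditioningPenalty
import Mathlib.Tactic.Linarith
import Mathlib.Tactic.Ring
import HarnessLib

/-!
# `NoHeavyLowerTail` (stmt-CriticalPhenomena-4575) — conditioning and Sahi's functionals: the `E₂` row for every coordinate set, and the triple-gap bound for `E₃`

Support file, seat `prim-l12-p5` (gen 3), `--supports stmt-CriticalPhenomena-4575`.  No definitions, no named facts, no sorries.
Companion of `…SahiConditioningPenalty` (the `E₃` conditioning penalty `Z_S ≤ E₃ + E F_a·Cov(F_b,F_c)`).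

* **`sectionSum_two_le_sahiE_two`** — the `E₂` row of the conditioning landscape for an ARBITRARY coordinate set `S` (the tree's
  `coinfluence_le_sahiE_two` is the case `S = univ ∖ {j}`): for nonnegative monotone `f, g` on a finite product cube,
  `Σ_v w_S(v)·E₂(sections at x_S = v) ≤ E₂(f,g) = Cov(f,g)` — conditioning on any set of coordinates can only LOWER the expected covariance
  (law of total covariance; the remainder `Cov_S(E[f|x_S], E[g|x_S])` is nonnegative by Harris on the `S`-cube).  So for `E₂` every `S` is
  "good" in the sense of `SubsetChordSuperlinear`; for `E₃` the penalty is at most `min_a E F_a·Cov(F_b,F_c)` (companion file) and can be positive.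
* **`sectionSum_le_two_mul_tripleGap`** — for nonnegative monotone `F₀,F₁,F₂` and every `S`:
  `Σ_v w_S(v)·E₃(sections at x_S = v) ≤ 2·(E(F₀F₁F₂) − E F₀·E F₁·E F₂)`: the expected `E₃` after conditioning never exceeds twice the triple
  Harris gap (moment form of the penalty + Harris `E F₀·E F₂ ≤ E(F₀F₂)`, `E F₀·E F₁ ≤ E(F₀F₁)`).
-/

namespace Summit.CriticalPhenomena.PercolationContinuityZ3.Theorems

namespace SahiSubsetChord

open Finset Literature.Combinatorics.Sahi2008

variable {ι : Type*} [Fintype ι] [DecidableEq ι]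

/-- **The `E₂` row for every coordinate set.**  For nonnegative monotone `f, g` on a finite product cube and every `S`:
`Σ_v w_S(v)·E₂(sections of (f,g) at x_S = v) ≤ E₂(f,g)`. [this file] -/
theorem sectionSum_two_le_sahiE_two (q : ι → ℝ) (hq : ∀ i, 0 ≤ q i ∧ q i ≤ 1) (f g : (ι → Bool) → ℝ)
    (hf0 : ∀ x, 0 ≤ f x) (hg0 : ∀ x, 0 ≤ g x) (hfm : Monotone f) (hgm : Monotone g) (S : Finset ι) :
    ∑ v : ({i // i ∈ S} → Bool), prodWeight (fun i : {i // i ∈ S} => q i) v *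
        sahiE (prodWeight fun i : {i // i ∉ S} => q i) 2 ![fun y => f (glue S v y), fun y => g (glue S v y)]
      ≤ sahiE (prodWeight q) 2 ![f, g] := by
  set wS : ({i // i ∈ S} → Bool) → ℝ := prodWeight (fun i : {i // i ∈ S} => q i) with hwS
  set wT : ({i // i ∉ S} → Bool) → ℝ := prodWeight (fun i : {i // i ∉ S} => q i) with hwT
  have hwT0 : ∀ y, 0 ≤ wT y := fun y => prodWeight_nonneg (q := fun i : {i // i ∉ S} => q i) (fun i => hq i) y
  have hFKGS : IsFKGMeasure wS := isFKGMeasure_coinWeight (fun i => hq i)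
  set av : (({i // i ∈ S} → Bool)) → ℝ := fun v => ex wT (fun y => f (glue S v y)) with hav
  set bv : (({i // i ∈ S} → Bool)) → ℝ := fun v => ex wT (fun y => g (glue S v y)) with hbv
  set mv : (({i // i ∈ S} → Bool)) → ℝ := fun v => ex wT (fun y => (f * g) (glue S v y)) with hmv
  have ea : ex (prodWeight q) f = ∑ v, wS v * av v := ex_prodWeight_eq_sum_glue q S f
  have eb : ex (prodWeight q) g = ∑ v, wS v * bv v := ex_prodWeight_eq_sum_glue q S g
  have em : ex (prodWeight q) (f * g) = ∑ v, wS v * mv v := ex_prodWeight_eq_sum_glue q S (f * g)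
  have hsec : ∀ v, sahiE wT 2 ![fun y => f (glue S v y), fun y => g (glue S v y)] = mv v - av v * bv v := by
    intro v
    rw [sahiE_two]
    rfl
  have ma : Monotone av := fun v v' hvv' => ex_mono hwT0 fun y => hfm (glue_mono_left S y hvv')
  have mb : Monotone bv := fun v v' hvv' => ex_mono hwT0 fun y => hgm (glue_mono_left S y hvv')
  have ha0 : ∀ v, 0 ≤ av v := fun v => ex_nonneg hwT0 (fun y => hf0 _)
  have hb0 : ∀ v, 0 ≤ bv v := fun v => ex_nonneg hwT0 (fun y => hg0 _)
  have H : (∑ v, wS v * av v) * (∑ v, wS v * bv v) ≤ ∑ v, wS v * (av v * bv v) := by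
    have key := ex_mul_ex_le_ex_mul hFKGS (f := av) (g := bv) ha0 hb0 ma mb
    simpa [ex, Pi.mul_apply] using key
  have hexp : ∑ v, wS v * sahiE wT 2 ![fun y => f (glue S v y), fun y => g (glue S v y)]
      = (∑ v, wS v * mv v) - ∑ v, wS v * (av v * bv v) := by
    rw [← Finset.sum_sub_distrib]
    exact Finset.sum_congr rfl fun v _ => by rw [hsec v]; ring
  rw [hexp, sahiE_two, ea, eb, em]
  linarith [H]

/-- **Triple-gap bound.**  For nonnegative monotone `F₀,F₁,F₂` on a finite product cube and every coordinate set `S`: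
`Σ_v w_S(v)·E₃(sections at x_S = v) ≤ 2·(E(F₀F₁F₂) − E F₀·E F₁·E F₂)`. [this file] -/
theorem sectionSum_le_two_mul_tripleGap (q : ι → ℝ) (hq : ∀ i, 0 ≤ q i ∧ q i ≤ 1) (F : Fin 3 → (ι → Bool) → ℝ)
    (hF0 : ∀ a x, 0 ≤ F a x) (hFm : ∀ a, Monotone (F a)) (S : Finset ι) :
    ∑ v : ({i // i ∈ S} → Bool), prodWeight (fun i : {i // i ∈ S} => q i) v *
        sahiE (prodWeight fun i : {i // i ∉ S} => q i) 3 (fun a y => F a (glue S v y))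
      ≤ 2 * (ex (prodWeight q) (F 0 * F 1 * F 2)
          - ex (prodWeight q) (F 0) * ex (prodWeight q) (F 1) * ex (prodWeight q) (F 2)) := by
  have h := sectionSum_le_moments q hq F hF0 hFm S
  have hFKG : IsFKGMeasure (prodWeight q) := isFKGMeasure_coinWeight hq
  have h02 : ex (prodWeight q) (F 0) * ex (prodWeight q) (F 2) ≤ ex (prodWeight q) (F 0 * F 2) :=
    ex_mul_ex_le_ex_mul hFKG (hF0 0) (hF0 2) (hFm 0) (hFm 2)
  have h01 : ex (prodWeight q) (F 0) * ex (prodWeight q) (F 1) ≤ ex (prodWeight q) (F 0 * F 1) :=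
    ex_mul_ex_le_ex_mul hFKG (hF0 0) (hF0 1) (hFm 0) (hFm 1)
  have h1 : 0 ≤ ex (prodWeight q) (F 1) := ex_nonneg (fun x => prodWeight_nonneg hq x) (hF0 1)
  have h2 : 0 ≤ ex (prodWeight q) (F 2) := ex_nonneg (fun x => prodWeight_nonneg hq x) (hF0 2)
  have t1 := mul_le_mul_of_nonneg_left h02 h1
  have t2 := mul_le_mul_of_nonneg_left h01 h2
  linarith [h, t1, t2]

end SahiSubsetChord

end Summit.CriticalPhenomena.PercolationContinuityZ3.Theorems
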